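import Literature.Computability.QuantumComplexity.StabilizerSimulationGadgetProofs
import HarnessLib

/-!
# Gadgetization with an explicit Clifford gate list

Topic `Literature/Computability/QuantumComplexity`, namespace `StabilizerFormalism`; support file for
the discharge of `MehrabanTahmasbi2024_PSharpP_subset_PPoly_of_stabilizerRank_poly`
(`StabilizerRankPermanent.lean`). `StabilizerSimulationGadgetProofs.gadgetize` writes an oracle-free
Clifford+`T` circuit `U` with `t` `T`-gates as `U ψ = c · (1 ⊗ ⟨0^t|) C (ψ ⊗ |T⟩^{⊗t})` with `C` SOME
element of the Clifford monoid (Bravyi et al. 2019, §2.3.1 eq. (16)). A polynomial-time machine,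
however, consumes `C` as a GATE LIST: here the same induction is redone keeping `C` as an explicit
`T`-free, oracle-free list of Clifford+`T` gates on `N + t` wires (each Clifford gate transported along
`Fin.castAddEmb`, each `T` gate replaced by one `CNOT` onto a fresh magic wire), with the explicit
scalar `c = (√2)^t`:

* `tCount_map_mapWiresGate`, `isOracleFree_map_mapWiresGate` — transport bookkeeping;
* **`gadgetizeList`** — `∃ C` (oracle-free, `T`-count `0`) with
  `U ψ = (√2)^t · projZ t (C (ψ ⊗ |T⟩^{⊗t}))` for all `ψ`;
* `mulVec_tensorVec_basisState_apply` — the entry formula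
  `(M (|w⟩ ⊗ ξ))(z) = Σ_v M[z, (w, v)] ξ(v)` used to read such identities as statements about
  amplitudes.

## References

* S. Bravyi, D. Browne, P. Calpin, E. Campbell, D. Gosset, M. Howard, *Simulation of quantum
  circuits by low-rank stabilizer decompositions*, Quantum 3 (2019) 181, §2.3.1 eqs. (15)–(16).
* S. Mehraban, M. Tahmasbi, arXiv:2305.10277 (STOC 2024), proof of Thm. 1.6 ("for an appropriate
  polynomial-size Clifford circuit `C_f`").
-/

noncomputable section

namespace Literature.Computability.QuantumComplexity

open _root_.Computability Cryptography Matrix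

namespace StabilizerFormalism

variable {N : ℕ}

/-! ### Transport bookkeeping -/

/-- Transport along a wire embedding preserves being a `T` gate. [folklore] -/
theorem isT_mapWiresGate {N' : ℕ} (ι : Fin N ↪ Fin N') (g : QGate cliffordT N) :
    (mapWiresGate ι g).isT = g.isT := by
  cases g with
  | gate g e => cases g <;> rfl
  | oracle k e => rfl

/-- Transport preserves the `T`-count of a gate list. [folklore] -/
theorem tCount_map_mapWiresGate {N' : ℕ} (ι : Fin N ↪ Fin N') (L : List (QGate cliffordT N)) :
    (⟨L.map (mapWiresGate ι)⟩ : QCircuit cliffordT N').tCount = (⟨L⟩ : QCircuit cliffordT N).tCount := by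
  induction L with
  | nil => rfl
  | cons g L ih =>
    rw [List.map_cons, QCircuit.tCount_cons, QCircuit.tCount_cons, isT_mapWiresGate]
    exact congrArg (· + _) ih

/-- Transport preserves oracle-freeness of a gate list. [folklore] -/
theorem isOracleFree_map_mapWiresGate {N' : ℕ} (ι : Fin N ↪ Fin N') {L : List (QGate cliffordT N)}
    (hL : ∀ g ∈ L, g.IsOracleFree) : ∀ g ∈ L.map (mapWiresGate ι), g.IsOracleFree := by
  intro g hg
  obtain ⟨g', hg', rfl⟩ := List.mem_map.1 hg
  exact isOracleFree_mapWiresGate ι (hL g' hg')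

/-- The matrix of a transported gate list. [cite: NielsenChuang2010, §4.2] -/
theorem toMatrix_map_mapWiresGate {N' : ℕ} (ι : Fin N ↪ Fin N') (A : Language Bool) (L : List (QGate cliffordT N)) :
    (⟨L.map (mapWiresGate ι)⟩ : QCircuit cliffordT N').toMatrix A = placeGate ι ((⟨L⟩ : QCircuit cliffordT N).toMatrix A) :=
  toMatrix_mapWires ι A ⟨L⟩

/-! ### Gadgetization, list form -/

/-- One Clifford gate more, list form: prepend the transported gate. [cite: BravyiEtAl2019, §2.3.1] -/
theorem gadgetizeList_clifford_step (A : Language Bool) {t : ℕ} (g : QGate cliffordT N) {c : ℂ}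
    {C : List (QGate cliffordT (N + t))} {L : List (QGate cliffordT N)}
    (hV : ∀ ψ : QReg N → ℂ, (⟨L⟩ : QCircuit cliffordT N).toMatrix A *ᵥ ψ =
      c • projZ t ((⟨C⟩ : QCircuit cliffordT (N + t)).toMatrix A *ᵥ tensorVec ψ (tensorPow magicT t)))
    (ψ : QReg N → ℂ) :
    (⟨g :: L⟩ : QCircuit cliffordT N).toMatrix A *ᵥ ψ =
      c • projZ t ((⟨mapWiresGate (Fin.castAddEmb t) g :: C⟩ : QCircuit cliffordT (N + t)).toMatrix A *ᵥ
        tensorVec ψ (tensorPow magicT t)) := by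
  rw [QCircuit.toMatrix_cons, ← Matrix.mulVec_mulVec, hV, QCircuit.toMatrix_cons, toMatrix_mapWiresGate,
    ← Matrix.mulVec_mulVec, placeGate_castAddEmb_mulVec_tensorVec]

/-- The list of the `T` step: a `CNOT` from wire `q` onto the fresh magic wire `N + t`, then the old
list transported along `Fin.castAddEmb 1`. [cite: BravyiEtAl2019, §2.3.1 eqs. (15)–(16)] -/
def tStepList (t : ℕ) (q : Fin N) (C : List (QGate cliffordT (N + t))) : List (QGate cliffordT (N + t + 1)) :=
  cnotOn (Fin.castAdd 1 (Fin.castAdd t q)) (Fin.natAdd (N + t) 0) (castAdd_one_ne_natAdd (Fin.castAdd t q)) ::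
    C.map (mapWiresGate (Fin.castAddEmb 1))

/-- One `T` gate more, list form: a fresh magic wire, a `CNOT` gadget onto it, and the old list
transported along `Fin.castAddEmb 1`. [cite: BravyiEtAl2019, §2.3.1 eqs. (15)–(16)] -/
theorem gadgetizeList_T_step (A : Language Bool) {t : ℕ} (q : Fin N) {c : ℂ}
    {C : List (QGate cliffordT (N + t))} {L : List (QGate cliffordT N)}
    (hV : ∀ ψ : QReg N → ℂ, (⟨L⟩ : QCircuit cliffordT N).toMatrix A *ᵥ ψ =
      c • projZ t ((⟨C⟩ : QCircuit cliffordT (N + t)).toMatrix A *ᵥ tensorVec ψ (tensorPow magicT t)))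
    (ψ : QReg N → ℂ) :
    ((⟨L⟩ : QCircuit cliffordT N).toMatrix A * placeGate (wireEmb q) tGate) *ᵥ ψ =
      (c * invSqrt2⁻¹) • projZ (t + 1)
        ((⟨tStepList t q C⟩ : QCircuit cliffordT (N + (t + 1))).toMatrix A *ᵥ
          tensorVec ψ (tensorPow magicT (t + 1))) := by
  have hne := castAdd_one_ne_natAdd (Fin.castAdd t q)
  have hgad := projZ_cnot_mulVec_tensorVec_magicT (Fin.castAdd t q) (tensorVec ψ (tensorPow magicT t))
  rw [tensorVec_tensorVec_one, ← wireEmb_trans_castAddEmb, ← placeGate_placeGate,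
    placeGate_castAddEmb_mulVec_tensorVec] at hgad
  have hgad' : tensorVec (placeGate (wireEmb q) tGate *ᵥ ψ) (tensorPow magicT t) =
      invSqrt2⁻¹ • projZ 1 (placeGate (pairEmb (Fin.castAdd 1 (Fin.castAdd t q)) (Fin.natAdd (N + t) 0) hne) cnot *ᵥ
        tensorVec (a := N) (b := t + 1) ψ (tensorPow magicT (t + 1))) := by
    rw [tensorPow_succ_eq, hgad, smul_smul, inv_mul_cancel₀ invSqrt2_ne_zero, one_smul]
  rw [← Matrix.mulVec_mulVec, hV, hgad', Matrix.mulVec_smul, projZ_smul, smul_smul, projZ_succ t,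
    show ((⟨tStepList t q C⟩ : QCircuit cliffordT (N + (t + 1))).toMatrix A) =
      placeGate (Fin.castAddEmb 1) ((⟨C⟩ : QCircuit cliffordT (N + t)).toMatrix A) *
        placeGate (pairEmb (Fin.castAdd 1 (Fin.castAdd t q)) (Fin.natAdd (N + t) 0) hne) cnot by
      rw [tStepList, QCircuit.toMatrix_cons, toMatrix_map_mapWiresGate, cnotOn_toMatrix],
    ← Matrix.mulVec_mulVec, projZ_placeGate_castAddEmb_mulVec]

/-- **Gadgetization with an explicit gate list** (Bravyi et al. 2019, §2.3.1 eq. (16)): for an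
oracle-free Clifford+`T` gate list `L` with `t` `T`-gates there is an ORACLE-FREE, `T`-FREE gate list
`C` on `N + t` wires with `U_L ψ = (√2)^t · (1 ⊗ ⟨0^t|) U_C (ψ ⊗ |T⟩^{⊗t})` for every `ψ`.
[cite: BravyiEtAl2019, §2.3.1 eq. (16)] -/
theorem gadgetizeList (A : Language Bool) :
    ∀ (L : List (QGate cliffordT N)), (∀ g ∈ L, g.IsOracleFree) → ∀ t : ℕ,
      (⟨L⟩ : QCircuit cliffordT N).tCount = t →
        ∃ C : List (QGate cliffordT (N + t)), (∀ g ∈ C, g.IsOracleFree) ∧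
          (⟨C⟩ : QCircuit cliffordT (N + t)).tCount = 0 ∧
          ∀ ψ : QReg N → ℂ, (⟨L⟩ : QCircuit cliffordT N).toMatrix A *ᵥ ψ =
            (invSqrt2⁻¹ ^ t) • projZ t ((⟨C⟩ : QCircuit cliffordT (N + t)).toMatrix A *ᵥ tensorVec ψ (tensorPow magicT t))
  | [], _, t, ht => by
    rw [QCircuit.tCount_nil] at ht
    subst ht
    refine ⟨[], fun _ h => absurd h List.not_mem_nil, rfl, fun ψ => ?_⟩
    rw [QCircuit.toMatrix_nil, Matrix.one_mulVec, Matrix.one_mulVec, pow_zero, one_smul,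
      projZ_zero_tensorVec_tensorPow_zero]
  | QGate.oracle k e :: L, hof, t, _ => absurd (hof _ List.mem_cons_self) id
  | QGate.gate g e :: L, hof, t, ht => by
    have hofL : ∀ g' ∈ L, QGate.IsOracleFree g' := fun g' hg' => hof g' (List.mem_cons_of_mem _ hg')
    rw [QCircuit.tCount_cons] at ht
    cases g with
    | T =>
      rw [QGate.isT_gate_T, if_pos rfl] at ht
      subst ht
      obtain ⟨C, hC, hC0, hV⟩ := gadgetizeList A L hofL _ rfl
      refine ⟨tStepList _ (embT e 0) C, ?_, ?_, fun ψ => ?_⟩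
      · intro g hg
        rcases List.mem_cons.1 hg with rfl | hg
        · exact trivial
        · exact isOracleFree_map_mapWiresGate _ hC g hg
      · rw [show ((⟨tStepList _ (embT e 0) C⟩ : QCircuit cliffordT _).tCount) =
            (⟨C.map (mapWiresGate (Fin.castAddEmb 1))⟩ : QCircuit cliffordT _).tCount + 0 from QCircuit.tCount_cons _ _,
          tCount_map_mapWiresGate, hC0]
      · rw [QCircuit.toMatrix_cons, QGate.toMatrix_gate,
          show placeGate e (cliffordT.mat CliffordTOp.T) = placeGate (wireEmb (embT e 0)) tGate from
            congrArg (fun f : Fin 1 ↪ Fin N => placeGate f tGate) (emb_one_eq_wireEmb (embT e)),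
          gadgetizeList_T_step A (embT e 0) hV, pow_succ]
    | H =>
      rw [QGate.isT_gate_H] at ht
      simp only [Bool.false_eq_true, if_false, add_zero] at ht
      obtain ⟨C, hC, hC0, hV⟩ := gadgetizeList A L hofL t ht
      refine ⟨_, ?_, ?_, gadgetizeList_clifford_step A _ hV⟩
      · intro g hg
        rcases List.mem_cons.1 hg with rfl | hg
        · exact trivial
        · exact hC g hg
      · rw [QCircuit.tCount_cons, hC0]; rfl
    | S =>
      rw [QGate.isT_gate_S] at ht
      simp only [Bool.false_eq_true, if_false, add_zero] at ht
      obtain ⟨C, hC, hC0, hV⟩ := gadgetizeList A L hofL t ht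
      refine ⟨_, ?_, ?_, gadgetizeList_clifford_step A _ hV⟩
      · intro g hg
        rcases List.mem_cons.1 hg with rfl | hg
        · exact trivial
        · exact hC g hg
      · rw [QCircuit.tCount_cons, hC0]; rfl
    | CNOT =>
      rw [QGate.isT_gate_CNOT] at ht
      simp only [Bool.false_eq_true, if_false, add_zero] at ht
      obtain ⟨C, hC, hC0, hV⟩ := gadgetizeList A L hofL t ht
      refine ⟨_, ?_, ?_, gadgetizeList_clifford_step A _ hV⟩
      · intro g hg
        rcases List.mem_cons.1 hg with rfl | hg
        · exact trivial
        · exact hC g hg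
      · rw [QCircuit.tCount_cons, hC0]; rfl

/-! ### Reading gadget identities as amplitudes -/

/-- **Entry formula**: `(M (|w⟩ ⊗ ξ))(z) = Σ_v M[z, (w, v)] ξ(v)`. [cite: NielsenChuang2010, §2.1.7] -/
theorem mulVec_tensorVec_basisState_apply {t : ℕ} (M : Matrix (QReg (N + t)) (QReg (N + t)) ℂ) (w : QReg N)
    (ξ : QReg t → ℂ) (z : QReg (N + t)) :
    (M *ᵥ tensorVec (basisState w) ξ) z = ∑ v : QReg t, M z (Fin.append w v) * ξ v := by
  rw [Matrix.mulVec, dotProduct, sum_qReg_add]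
  rw [Finset.sum_eq_single w]
  · refine Finset.sum_congr rfl fun v _ => ?_
    rw [tensorVec_append, basisState_apply, if_pos rfl, one_mul]
  · intro a _ ha
    refine Finset.sum_eq_zero fun v _ => ?_
    rw [tensorVec_append, basisState_apply, if_neg ha, zero_mul, mul_zero]
  · intro h; exact absurd (Finset.mem_univ _) h

/-- `projZ` reads the entry at the label extended by zeros (restated for rewriting). [folklore] -/
theorem projZ_apply' {t : ℕ} (Φ : QReg (N + t) → ℂ) (x : QReg N) : projZ t Φ x = Φ (Fin.append x fun _ => false) := rfl

end StabilizerFormalism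

end Literature.Computability.QuantumComplexity
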